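import Literature.Analysis.Complex.IsolatedSingularityDichotomy
import Literature.AnabelianGeometry.AbsoluteAnabelian.AutHolomorphicSpacesTransportProofs
import Literature.AnabelianGeometry.AbsoluteAnabelian.RCHolomorphicInverse
import Mathlib.Topology.Compactness.Compact
import HarnessLib

/-!
# Biholomorphisms between finitely punctured planes, I: behaviour at the punctures

Classical: a biholomorphic map `ℂ ∖ S → ℂ ∖ T` between complements of FINITE sets extends to a Möbius
transformation of the Riemann sphere carrying `S ∪ {∞}` onto `T ∪ {∞}` (J. B. Conway, *Functions of
One Complex Variable I* (1978), Ch. V §1 — isolated singularities, Thm. 1.21 Casorati–Weierstrass,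
Def. 1.3 — with Ch. III §3, Möbius transformations; R. Remmert, *Classical Topics in Complex Function
Theory*, Ch. 10).  The tree's `ThricePuncturedSphereEnds` / `ThricePuncturedSphereAutomorphisms` treat
`S = T = {0, 1}`; THIS file generalises the first of them to arbitrary finite `S`, `T` and to maps
between DIFFERENT punctured planes.  For a homeomorphism `φ : U ≃ₜ V` of open subsets `U = ℂ ∖ S`,
`V = ℂ ∖ T` which is holomorphic (`MDifferentiable`, the charted-space structure of abc-iut-L4's
`holAut` files) and an ambient representative `f : ℂ → ℂ` of `φ`:

* the ENDS of `ℂ ∖ S` are the filters `𝓝[≠] p` (`p ∈ S`) and `cocompact ℂ` (the puncture `∞`); they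
  are non-trivial, pairwise disjoint, eventually inside `U` and eventually outside every compact subset
  of `U` (`PuncturedPlane.eventually_mem_of_isEnd`, `…_not_mem_of_isCompact`, `disjoint_of_isEnd_of_ne`);
* `PuncturedPlane.mdifferentiable_symm` — the inverse of a holomorphic homeomorphism of Riemann
  surfaces is holomorphic (abc-iut-L4-t8's `IsHolAt.symm_apply`);
* `PuncturedPlane.eventually_le_norm_sub` — `f` omits a disc near every end (injectivity + openness);
* `PuncturedPlane.end_trichotomy` — along every end of `ℂ ∖ S`, `f` tends to an end of `ℂ ∖ T`
  (Casorati–Weierstrass contrapositive `IsolatedSingularityDichotomy` + a compactness argument excluding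
  finite limits inside `V`);
* `PuncturedPlane.end_injective` — distinct ends go to distinct ends (trichotomy for `φ⁻¹`).

No definitions: «`l` is an end of `ℂ ∖ S`» is spelled `l = cocompact ℂ ∨ ∃ p ∈ S, l = 𝓝[≠] p`.
[cite: Conway1978, Ch. V Thm. 1.21 and Def. 1.3]
-/

noncomputable section

namespace Literature.Analysis.Complex

namespace PuncturedPlane

open _root_.Filter _root_.Topology _root_.Metric _root_.Bornology _root_.Set _root_.Function
open scoped _root_.Manifold _root_.ContDiff
open _root_.TopologicalSpace (Opens)
open Literature.AnabelianGeometry.AbsoluteAnabelian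

variable {S T : Set ℂ} {U V : Opens ℂ} (hU : (U : Set ℂ) = Sᶜ) (hV : (V : Set ℂ) = Tᶜ)

/-! ### The domain `ℂ ∖ S` and its ends -/

include hU in
/-- Membership in `U = ℂ ∖ S`. [cite: Conway1978, Ch. V Def. 1.3] -/
theorem mem_iff {z : ℂ} : z ∈ U ↔ z ∉ S := by
  change z ∈ (U : Set ℂ) ↔ _
  rw [hU]; rfl

include hU in
/-- Near a puncture `p ∈ S` (punctured neighbourhoods), every point lies in `U` (`S` finite).
[cite: Conway1978, Ch. V Def. 1.3] -/
theorem eventually_mem_nhdsNE (hS : S.Finite) {p : ℂ} : ∀ᶠ z in 𝓝[≠] p, z ∈ U := by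
  have hc : IsClosed (S \ {p}) := (hS.subset fun _ h => h.1).isClosed
  have hp : p ∉ S \ {p} := fun h => h.2 rfl
  have h1 : ∀ᶠ z in 𝓝 p, z ∉ S \ {p} := hc.isOpen_compl.mem_nhds hp
  have h2 : ∀ᶠ z in 𝓝[≠] p, z ≠ p := self_mem_nhdsWithin
  filter_upwards [mem_nhdsWithin_of_mem_nhds h1, h2] with z hz hzp
  rw [mem_iff hU]
  exact fun hzS => hz ⟨hzS, hzp⟩

include hU in
/-- Near `∞` every point lies in `U` (`S` finite, hence compact). [cite: Conway1978, Ch. V Def. 1.3] -/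
theorem eventually_mem_cocompact (hS : S.Finite) : ∀ᶠ z in cocompact ℂ, z ∈ U := by
  filter_upwards [hS.isCompact.compl_mem_cocompact] with z hz
  exact (mem_iff hU).mpr hz

/-- Every end is a non-trivial filter. [cite: Conway1978, Ch. V Def. 1.3] -/
theorem neBot_of_isEnd {l : Filter ℂ} (hl : l = cocompact ℂ ∨ ∃ p ∈ S, l = 𝓝[≠] p) : l.NeBot := by
  rcases hl with rfl | ⟨p, -, rfl⟩
  · infer_instance
  · exact NormedField.nhdsNE_neBot p

include hU in
/-- Along every end, points eventually lie in `U`. [cite: Conway1978, Ch. V Def. 1.3] -/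
theorem eventually_mem_of_isEnd (hS : S.Finite) {l : Filter ℂ}
    (hl : l = cocompact ℂ ∨ ∃ p ∈ S, l = 𝓝[≠] p) : ∀ᶠ z in l, z ∈ U := by
  rcases hl with rfl | ⟨p, -, rfl⟩
  · exact eventually_mem_cocompact hU hS
  · exact eventually_mem_nhdsNE hU hS

include hU in
/-- Along every end, points eventually leave any compact subset of `ℂ` contained in `U`.
[cite: Conway1978, Ch. V Def. 1.3] -/
theorem eventually_not_mem_of_isCompact {l : Filter ℂ} (hl : l = cocompact ℂ ∨ ∃ p ∈ S, l = 𝓝[≠] p)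
    {A : Set ℂ} (hA : IsCompact A) (hAU : A ⊆ (U : Set ℂ)) : ∀ᶠ z in l, z ∉ A := by
  rcases hl with rfl | ⟨p, hp, rfl⟩
  · exact hA.compl_mem_cocompact
  · have hpA : p ∉ A := fun h => (mem_iff hU).mp (hAU h) hp
    exact mem_nhdsWithin_of_mem_nhds (hA.isClosed.isOpen_compl.mem_nhds hpA)

/-- Distinct ends are disjoint filters (distinct points have disjoint neighbourhoods; a neighbourhood
of a finite puncture is bounded). [cite: Conway1978, Ch. V Def. 1.3] -/
theorem disjoint_of_isEnd_of_ne {l l' : Filter ℂ} (hl : l = cocompact ℂ ∨ ∃ p ∈ S, l = 𝓝[≠] p)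
    (hl' : l' = cocompact ℂ ∨ ∃ p ∈ S, l' = 𝓝[≠] p) (hne : l ≠ l') : Disjoint l l' := by
  have key : ∀ p : ℂ, Disjoint (𝓝[≠] p) (cocompact ℂ) := fun p =>
    Filter.disjoint_iff.mpr ⟨_, mem_nhdsWithin_of_mem_nhds (closedBall_mem_nhds p one_pos), _,
      (isCompact_closedBall p 1).compl_mem_cocompact, disjoint_compl_right⟩
  rcases hl with rfl | ⟨p, -, rfl⟩ <;> rcases hl' with rfl | ⟨q, -, rfl⟩
  · exact (hne rfl).elim
  · exact (key q).symm
  · exact key p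
  · have hpq : p ≠ q := fun h => hne (by rw [h])
    exact ((disjoint_nhds_nhds.mpr hpq).mono nhdsWithin_le_nhds nhdsWithin_le_nhds)

/-- The end `f` tends to along a non-trivial filter is unique. [cite: Conway1978, Ch. V Def. 1.3] -/
theorem end_unique {f : ℂ → ℂ} {l l₁ l₂ : Filter ℂ} [l.NeBot]
    (hl₁ : l₁ = cocompact ℂ ∨ ∃ q ∈ T, l₁ = 𝓝[≠] q) (hl₂ : l₂ = cocompact ℂ ∨ ∃ q ∈ T, l₂ = 𝓝[≠] q)
    (h₁ : Tendsto f l l₁) (h₂ : Tendsto f l l₂) : l₁ = l₂ := by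
  by_contra hne
  have hd := disjoint_of_isEnd_of_ne hl₁ hl₂ hne
  have hle : map f l ≤ l₁ ⊓ l₂ := le_inf h₁ h₂
  rw [hd.eq_bot, le_bot_iff] at hle
  exact (map_neBot (f := l) (m := f)).ne hle

/-! ### The ambient representative of a biholomorphism `U ≃ V` -/

section Biholomorphism

variable {φ : U ≃ₜ V} {f : ℂ → ℂ}

/-- `φ` maps into `V`: `f z ∈ V` for `z ∈ U`. [cite: Conway1978, Ch. V Def. 1.3] -/
theorem apply_mem (hf : ∀ x : U, (φ x : ℂ) = f x) {z : ℂ} (hz : z ∈ U) : f z ∈ V := by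
  rw [← hf ⟨z, hz⟩]; exact (φ ⟨z, hz⟩).2

/-- `f` is injective on `U`. [cite: Conway1978, Ch. V Def. 1.3] -/
theorem injOn (hf : ∀ x : U, (φ x : ℂ) = f x) : InjOn f U := by
  intro z hz z' hz' h
  have : φ ⟨z, hz⟩ = φ ⟨z', hz'⟩ := Subtype.ext (by rw [hf, hf]; exact h)
  exact congrArg Subtype.val (φ.injective this)

/-- The ambient representative of the inverse undoes `f` on `U`. [cite: Conway1978, Ch. V Def. 1.3] -/
theorem symm_apply_apply (hf : ∀ x : U, (φ x : ℂ) = f x) {f' : ℂ → ℂ}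
    (hf' : ∀ y : V, (φ.symm y : ℂ) = f' y) {z : ℂ} (hz : z ∈ U) : f' (f z) = z := by
  have h1 : f z = (φ ⟨z, hz⟩ : ℂ) := (hf ⟨z, hz⟩).symm
  have h2 : f' (φ ⟨z, hz⟩ : ℂ) = (φ.symm (φ ⟨z, hz⟩) : ℂ) := (hf' (φ ⟨z, hz⟩)).symm
  rw [h1, h2, φ.symm_apply_apply]

/-- **The inverse of a holomorphic homeomorphism of open subsets of `ℂ` is holomorphic** (the
holomorphic inverse function theorem on Riemann surfaces, abc-iut-L4-t8's `IsHolAt.symm_apply`).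
[cite: Conway1978, Ch. IV Thm. 7.5 and Cor. 7.6] -/
theorem mdifferentiable_symm (φ : U ≃ₜ V) (hφ : MDifferentiable 𝓘(ℂ, ℂ) 𝓘(ℂ, ℂ) φ) :
    MDifferentiable 𝓘(ℂ, ℂ) 𝓘(ℂ, ℂ) φ.symm := fun y => by
  have h : IsHolAt (⇑φ) (φ.symm y) := Eventually.of_forall fun x => hφ x
  have h' := h.symm_apply φ
  rw [φ.apply_symm_apply] at h'
  exact h'.mdifferentiableAt

/-- A holomorphic `φ` has a complex-differentiable ambient representative on `U`.
[cite: Conway1978, Ch. V Def. 1.3] -/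
theorem differentiableAt (hφ : MDifferentiable 𝓘(ℂ, ℂ) 𝓘(ℂ, ℂ) φ) (hf : ∀ x : U, (φ x : ℂ) = f x)
    {z : ℂ} (hz : z ∈ U) : DifferentiableAt ℂ f z := by
  have h1 := hφ ⟨z, hz⟩
  rw [mdifferentiableAt_opens_iff hf ⟨z, hz⟩] at h1
  exact mdifferentiableAt_iff_differentiableAt.mp h1

include hU in
/-- Along every end, `f` is eventually complex differentiable. [cite: Conway1978, Ch. V Def. 1.3] -/
theorem eventually_differentiableAt (hS : S.Finite) (hφ : MDifferentiable 𝓘(ℂ, ℂ) 𝓘(ℂ, ℂ) φ)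
    (hf : ∀ x : U, (φ x : ℂ) = f x) {l : Filter ℂ} (hl : l = cocompact ℂ ∨ ∃ p ∈ S, l = 𝓝[≠] p) :
    ∀ᶠ z in l, DifferentiableAt ℂ f z :=
  (eventually_mem_of_isEnd hU hS hl).mono fun _ hz => differentiableAt hφ hf hz

include hU in
/-- **`f` omits a disc away from a compact part of `U`**: there are a closed disc `D̄(z₀, r) ⊆ U`, a
point `w` and `δ > 0` with `δ ≤ ‖f z - w‖` for all `z ∈ U` outside `D(z₀, r)` (whose image under the open
injective map `φ` contains the disc `D(w, δ)`).  `S` finite makes `U` non-empty.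
[cite: Conway1978, Ch. V Thm. 1.21 and Def. 1.3] -/
theorem exists_le_norm_sub (hS : S.Finite) (hf : ∀ x : U, (φ x : ℂ) = f x) :
    ∃ (z₀ : ℂ) (r : ℝ), 0 < r ∧ closedBall z₀ r ⊆ (U : Set ℂ) ∧
      ∃ (w : ℂ) (δ : ℝ), 0 < δ ∧ ∀ z ∈ U, z ∉ ball z₀ r → δ ≤ ‖f z - w‖ := by
  -- a closed disc inside `U`
  obtain ⟨z₀, hz₀⟩ := hS.infinite_compl.nonempty
  have hz₀U : z₀ ∈ U := (mem_iff hU).mpr hz₀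
  obtain ⟨ε, hε, hεU⟩ := Metric.isOpen_iff.mp U.2 z₀ hz₀U
  have hB : ball z₀ (ε / 2) ⊆ (U : Set ℂ) := (ball_subset_ball (by linarith)).trans hεU
  refine ⟨z₀, ε / 2, half_pos hε, (closedBall_subset_ball (by linarith)).trans hεU, ?_⟩
  -- the image of the open disc under `φ`, pushed to `ℂ`, is open and contains `f z₀`
  set B' : Set U := {x | (x : ℂ) ∈ ball z₀ (ε / 2)} with hB'
  have hB'o : IsOpen B' := isOpen_ball.preimage continuous_subtype_val
  have hVo : IsOpen (Subtype.val '' (φ '' B') : Set ℂ) :=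
    V.2.isOpenMap_subtype_val _ (φ.isOpenMap _ hB'o)
  have hw : f z₀ ∈ (Subtype.val '' (φ '' B') : Set ℂ) :=
    ⟨φ ⟨z₀, hz₀U⟩, ⟨⟨z₀, hz₀U⟩, mem_ball_self (half_pos hε), rfl⟩, hf _⟩
  obtain ⟨δ, hδ, hδV⟩ := Metric.isOpen_iff.mp hVo _ hw
  refine ⟨f z₀, δ, hδ, fun z hz hzB => ?_⟩
  by_contra hlt
  rw [not_le] at hlt
  have hmem : f z ∈ ball (f z₀) δ := by rwa [mem_ball, dist_eq_norm]
  obtain ⟨y, ⟨x, hxB, rfl⟩, hy⟩ := hδV hmem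
  -- `φ x = φ ⟨z, hz⟩`, hence `x = z ∈ D(z₀, ε/2)`: contradiction
  have hφx : φ x = φ ⟨z, hz⟩ := Subtype.ext (by rw [hy, hf])
  have hxz : x = ⟨z, hz⟩ := φ.injective hφx
  exact hzB (by have h' := hxB; rw [hxz] at h'; exact h')

include hU in
/-- Along every end, `f` eventually stays at distance `≥ δ` from some `w`.
[cite: Conway1978, Ch. V Thm. 1.21 and Def. 1.3] -/
theorem eventually_le_norm_sub (hS : S.Finite) (hf : ∀ x : U, (φ x : ℂ) = f x) {l : Filter ℂ}
    (hl : l = cocompact ℂ ∨ ∃ p ∈ S, l = 𝓝[≠] p) :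
    ∃ (w : ℂ) (δ : ℝ), 0 < δ ∧ ∀ᶠ z in l, δ ≤ ‖f z - w‖ := by
  obtain ⟨z₀, r, hr, hDU, w, δ, hδ, h⟩ := exists_le_norm_sub hU hS hf
  refine ⟨w, δ, hδ, ?_⟩
  filter_upwards [eventually_mem_of_isEnd hU hS hl,
    eventually_not_mem_of_isCompact hU hl (isCompact_closedBall z₀ r) hDU] with z hz hzK
  exact h z hz fun hb => hzK (ball_subset_closedBall hb)

include hU in
/-- **No finite limit inside `V` at an end.**  If `f → L` along an end of `U` then `L ∉ V`: otherwise
the points near the end would lie in the compact subset `φ⁻¹(closed disc around L)` of `U`.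
[cite: Conway1978, Ch. V Def. 1.3] -/
theorem not_mem_of_tendsto_nhds (hS : S.Finite) (hf : ∀ x : U, (φ x : ℂ) = f x) {l : Filter ℂ}
    (hl : l = cocompact ℂ ∨ ∃ p ∈ S, l = 𝓝[≠] p) {L : ℂ} (hL : Tendsto f l (𝓝 L)) : L ∉ V := by
  intro hLV
  haveI := neBot_of_isEnd hl
  -- a closed disc around `L` inside `V`
  obtain ⟨ε, hε, hεV⟩ := Metric.isOpen_iff.mp V.2 L hLV
  set D : Set ℂ := closedBall L (ε / 2) with hD
  have hDV : D ⊆ (V : Set ℂ) := (closedBall_subset_ball (by linarith)).trans hεV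
  -- its preimage under `φ`, pushed to `ℂ`, is compact and contained in `U`
  set K : Set V := {y | (y : ℂ) ∈ D} with hK
  have hKD : Subtype.val '' K = D := by
    ext z; constructor
    · rintro ⟨x, hx, rfl⟩; exact hx
    · intro hz; exact ⟨⟨z, hDV hz⟩, hz, rfl⟩
  have hKc : IsCompact K :=
    (Topology.IsInducing.subtypeVal.isCompact_iff).mpr (hKD ▸ isCompact_closedBall L (ε / 2))
  set A : Set ℂ := Subtype.val '' (φ.symm '' K) with hA
  have hAc : IsCompact A := (hKc.image φ.symm.continuous).image continuous_subtype_val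
  have hAU : A ⊆ (U : Set ℂ) := by rintro _ ⟨x, _, rfl⟩; exact x.2
  -- eventually `z ∈ A` (as `f z ∈ D`) and eventually `z ∉ A`: contradiction
  have hev : ∀ᶠ z in l, z ∈ A := by
    filter_upwards [eventually_mem_of_isEnd hU hS hl, hL (closedBall_mem_nhds L (half_pos hε))]
      with z hz hzD
    refine ⟨φ.symm (φ ⟨z, hz⟩), ⟨φ ⟨z, hz⟩, ?_, rfl⟩, by rw [φ.symm_apply_apply]⟩
    change (φ ⟨z, hz⟩ : ℂ) ∈ D
    rw [hf]; exact hzD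
  obtain ⟨z, hz1, hz2⟩ := (hev.and (eventually_not_mem_of_isCompact hU hl hAc hAU)).exists
  exact hz2 hz1

include hU hV in
/-- **Trichotomy at an end.**  For a biholomorphism `φ : ℂ ∖ S ≃ ℂ ∖ T` (`S`, `T` finite) with
ambient representative `f` and an end `l` of `ℂ ∖ S`: `f` tends along `l` to an end `l'` of `ℂ ∖ T`
(Casorati–Weierstrass, contrapositive, excludes an essential singularity; a finite limit cannot lie in
`V`, so it is a puncture `q ∈ T`, approached in the punctured sense since `f` takes values in `V`).
[cite: Conway1978, Ch. V Thm. 1.21 and Def. 1.3] -/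
theorem end_trichotomy (hS : S.Finite) (hφ : MDifferentiable 𝓘(ℂ, ℂ) 𝓘(ℂ, ℂ) φ)
    (hf : ∀ x : U, (φ x : ℂ) = f x) {l : Filter ℂ} (hl : l = cocompact ℂ ∨ ∃ p ∈ S, l = 𝓝[≠] p) :
    ∃ l' : Filter ℂ, (l' = cocompact ℂ ∨ ∃ q ∈ T, l' = 𝓝[≠] q) ∧ Tendsto f l l' := by
  obtain ⟨w, δ, hδ, hw⟩ := eventually_le_norm_sub hU hS hf hl
  have hd := eventually_differentiableAt hU hS hφ hf hl
  have hmemV : ∀ᶠ z in l, f z ∈ V :=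
    (eventually_mem_of_isEnd hU hS hl).mono fun z hz => apply_mem hf hz
  -- the dichotomy of `IsolatedSingularityDichotomy`, at a finite puncture or at `∞`
  have hdich : (∃ L : ℂ, Tendsto f l (𝓝 L)) ∨ Tendsto f l (cocompact ℂ) := by
    rcases hl with rfl | ⟨p, -, rfl⟩
    · exact exists_tendsto_nhds_or_tendsto_cocompact_atInfty_of_le_norm_sub hδ hd hw
    · exact exists_tendsto_nhds_or_tendsto_cocompact_of_le_norm_sub hδ hd hw
  rcases hdich with ⟨L, hL⟩ | hP
  · -- finite limit: `L ∈ T`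
    have hLV : L ∉ V := not_mem_of_tendsto_nhds hU hS hf hl hL
    have hLT : L ∈ T := by
      by_contra h
      exact hLV ((mem_iff hV).mpr h)
    have hne : ∀ᶠ z in l, f z ≠ L := hmemV.mono fun z hz h => hLV (h ▸ hz)
    exact ⟨𝓝[≠] L, Or.inr ⟨L, hLT, rfl⟩, tendsto_nhdsWithin_iff.mpr ⟨hL, hne⟩⟩
  · exact ⟨cocompact ℂ, Or.inl rfl, hP⟩

include hU hV in
/-- **Distinct ends go to distinct ends.**  If `f` tends to the same end of `ℂ ∖ T` along two ends
`l₁, l₂` of `ℂ ∖ S`, then `l₁ = l₂` (trichotomy for `φ⁻¹`, whose ambient representative undoes `f` on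
`U`). [cite: Conway1978, Ch. V Thm. 1.21 and Def. 1.3] -/
theorem end_injective (hS : S.Finite) (hT : T.Finite) (hφ : MDifferentiable 𝓘(ℂ, ℂ) 𝓘(ℂ, ℂ) φ)
    (hf : ∀ x : U, (φ x : ℂ) = f x) {l₁ l₂ l' : Filter ℂ}
    (hl₁ : l₁ = cocompact ℂ ∨ ∃ p ∈ S, l₁ = 𝓝[≠] p) (hl₂ : l₂ = cocompact ℂ ∨ ∃ p ∈ S, l₂ = 𝓝[≠] p)
    (hl' : l' = cocompact ℂ ∨ ∃ q ∈ T, l' = 𝓝[≠] q)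
    (h₁ : Tendsto f l₁ l') (h₂ : Tendsto f l₂ l') : l₁ = l₂ := by
  classical
  -- ambient representative of `φ⁻¹`
  let f' : ℂ → ℂ := fun z => if h : z ∈ V then (φ.symm ⟨z, h⟩ : ℂ) else 0
  have hf' : ∀ y : V, (φ.symm y : ℂ) = f' y := fun y => by
    simp only [f', dif_pos y.2]
  have hφ' : MDifferentiable 𝓘(ℂ, ℂ) 𝓘(ℂ, ℂ) φ.symm := mdifferentiable_symm φ hφ
  obtain ⟨l'', hl'', h''⟩ := end_trichotomy hV hU hT hφ' hf' hl'
  haveI := neBot_of_isEnd (S := S) hl₁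
  haveI := neBot_of_isEnd (S := S) hl₂
  -- `f' ∘ f = id` eventually along `l₁`, `l₂`; so `l_i ≤ l''`, whence `l_i = l''`
  have key : ∀ {l : Filter ℂ}, (l = cocompact ℂ ∨ ∃ p ∈ S, l = 𝓝[≠] p) → Tendsto f l l' →
      l = l'' := by
    intro l hl h
    haveI := neBot_of_isEnd (S := S) hl
    have hcomp : Tendsto (f' ∘ f) l l'' := h''.comp h
    have hid : (f' ∘ f) =ᶠ[l] id :=
      (eventually_mem_of_isEnd hU hS hl).mono fun z hz => symm_apply_apply hf hf' hz
    have hle : l ≤ l'' := by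
      have := hcomp.congr' hid
      rwa [tendsto_id'] at this
    -- comparable ends are equal
    by_contra hne
    have hd := disjoint_of_isEnd_of_ne hl hl'' hne
    have : l = ⊥ := by
      have h2 : l ⊓ l'' = l := inf_eq_left.mpr hle
      rw [← h2]; exact hd.eq_bot
    exact (neBot_of_isEnd (S := S) hl).ne this
  rw [key hl₁ h₁, key hl₂ h₂]

end Biholomorphism

end PuncturedPlane

end Literature.Analysis.Complex

end
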